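import Literature.AlgebraicGeometry.Frobenioids.ArithmeticRealificationPicDegree
import HarnessLib

/-!
# Frobenioids I, Thm. 6.4 (i)/(ii): the non-negative cone of `(Pic_Φ(A), δ_A)` IS the set of classes of
# `Φ^rlf(L)` (THE realified arithmetic Frobenioid `C_{K/F}^rlf`)

Mochizuki, *The geometry of Frobenioids I*, Kyushu J. Math. **62** (2008), Thm. 6.4 (ii), proof p. 115 l. 34 –
p. 116 l. 2: "the isomorphism of groups `Pic_Φ(A₁) ⥲ Pic_Φ(A₂)` determined by `Ψ^rlf` … is compatible with the
'order structure' induced on both sides [via `δ_{A₁}`, `δ_{A₂}`] by the 'order structure' of `ℝ`. [Indeed, this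
compatibility follows from the fact that the isomorphism in question arises from an isomorphism of monoids
`Φ₁^rlf(A₁) ⥲ Φ₂^rlf(A₂)`.]" [cite: MochizukiFrdI2008, Thm. 6.4 (ii) p.115] — the tacit step being that the
'order structure' pulled back along `δ_A` is the one whose non-negative cone consists of the classes of the
(effective) elements of `Φ^rlf(L)` [cite: MochizukiFrdI2008, Thm. 6.4 (i) p.115].

PROOF-ONLY (node FrdI:Thm6.4(i)/(ii), sub-DAG rows T64i/L15 interface + the `hmon`/`hcone` input of abc-iut-w4-d086's
`Thm64ii_L02_orderCompat_of_monoidIso` / `_of_cones` (row T64ii/L01 ⟹ L02); seat abc-iut-L1-d2, cell abc-iut).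
For THE descended degree `δ` of `ArithmeticRealificationPicDegree.lean` (any `d` extending `deg^arith_L`, any `δ` over
`((ℝ_{≥0})^gp → ℝ) ∘ d^gp`):
* `arith_picDegree_mk_of_nonneg` — classes of elements of `Φ^rlf(L)` have `δ ≥ 0`;
* `arith_picDegree_nonneg_iff` — **`δ(x) ≥ 0` iff `x` is the class of an element of `Φ^rlf(L)`** (even of an
  effective ARITHMETIC divisor `ι(D)`: `arith_picDegree_nonneg_iff_iota`), by `arith_exists_iota_picDegree_eq` and the
  injectivity of `δ`;
* `arith_mem_realSpan_iff_picDegree_eq_one` — `ξ ∈ (ℝ · Φ^birat)(L)` iff `δ[ξ] = 0` (the kernel of the real degree on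
  `(Φ^rlf)^gp(L)` IS `ℝ · Φ^birat(L)`: "the image of `Φ^birat(L) ⊗_ℤ ℝ = (L^×) ⊗_ℤ ℝ` in `(Φ^rlf_factor)^gp(L)` is equal
  to the set of elements of `(Φ^rlf_factor)^gp(L)` with finite support whose image under `deg^arith_L` is `0`", p. 115);
* **`arith_exists_div_toRlfGp_mem_realSpan`** (δ-free) — every `ξ ∈ (Φ^rlf)^gp(L)` is congruent modulo
  `(ℝ · Φ^birat)(L)` to `ι^gp(c)` for some `c ∈ Φ^gp(L)` (archimedean adjustment): every object `(Spec L, ξ)` of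
  `C_{K/F}^rlf` has the class of an `untrToRlf`-image object — the input (a′) of the as-typed strong clause of Cor. 5.4
  at `C_{K/F}` (L1-lead R111 (2), abc-iut-w5-d137's note 2026-08-26T04:51:47Z).
-/

noncomputable section

open scoped NNReal

namespace Literature.AlgebraicGeometry.Frobenioids

open CategoryTheory Opposite Function NumberField Literature.AnabelianGeometry.EtaleTheta

namespace ArithRlfPic

variable {F : Type} [Field F] [NumberField F] {K : Type} [Field K] [Algebra F K]
  (hΦ : PreFrobenioid.IsPerfFactorialOn (arithDivisorFunctor F K)) (X : FinSubextCat F K)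
  (d : (PreFrobenioid.IsPerfFactorialOn.op hΦ (op X)).Rlf →* Multiplicative ℝ≥0)
  (hd : ∀ D : EffArithDivisor X.L,
    ((Multiplicative.toAdd (d ((PreFrobenioid.IsPerfFactorialOn.op hΦ (op X)).toRealification
      (Perfection.of _ (Multiplicative.ofAdd D)))) : ℝ≥0) : ℝ) =
      arithDegree X.L (EffArithDivisor.toArithDivisor X.L D))
  (δ : ((RealificationData.canonical (arithDivisorFunctor F K) (PreFrobenioid.IsPerfFactorialOn.op hΦ)).realSpan
        (PreFrobenioid.biratSubfunctor
          (ModelFrobenioid.toElem (arithDivisorFunctor F K) (unitsFunctor F K) (divNatTrans F K)))).Pic X →*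
      Multiplicative ℝ)
  (hδ : δ.comp (QuotientGroup.mk' _) =
    (Algebra.GrothendieckGroup.lift
      (NNReal.toRealHom.toAddMonoidHom.toMultiplicative : Multiplicative ℝ≥0 →* Multiplicative ℝ)).comp
      (MonGp.map d))
include hδ

/-- **Classes of elements of `Φ^rlf(L)` have non-negative degree** (`δ [a] = d(a) ≥ 0`).
[cite: MochizukiFrdI2008, Thm. 6.4 (i) p.115] -/
theorem arith_picDegree_mk_of_nonneg (a : (PreFrobenioid.IsPerfFactorialOn.op hΦ (op X)).Rlf) :
    0 ≤ Multiplicative.toAdd (δ (QuotientGroup.mk' _ (Algebra.GrothendieckGroup.of a))) := by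
  rw [arith_picDegree_mk_of hΦ X d δ hδ, toAdd_ofAdd]
  exact NNReal.coe_nonneg _

include hd

/-- **The non-negative cone of `(Pic, δ)` consists of the classes of effective ARITHMETIC divisors `ι(D)`**
(`δ` is injective and every `t ≥ 0` is the degree of some `ι(D)`). [cite: MochizukiFrdI2008, Thm. 6.4 (i) p.115] -/
theorem arith_picDegree_nonneg_iff_iota
    (x : ((RealificationData.canonical (arithDivisorFunctor F K) (PreFrobenioid.IsPerfFactorialOn.op hΦ)).realSpan
        (PreFrobenioid.biratSubfunctor
          (ModelFrobenioid.toElem (arithDivisorFunctor F K) (unitsFunctor F K) (divNatTrans F K)))).Pic X) :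
    0 ≤ Multiplicative.toAdd (δ x) ↔ ∃ D : EffArithDivisor X.L, x = QuotientGroup.mk' _ (Algebra.GrothendieckGroup.of
      ((PreFrobenioid.IsPerfFactorialOn.op hΦ (op X)).toRealification (Perfection.of _ (Multiplicative.ofAdd D)))) := by
  constructor
  · intro hx
    obtain ⟨D, hD⟩ := arith_exists_iota_picDegree_eq hΦ X d hd δ hδ _ hx
    rw [ofAdd_toAdd] at hD
    exact ⟨D, (arith_picDegree_injective hΦ X d hd δ hδ hD).symm⟩
  · rintro ⟨D, rfl⟩
    exact arith_picDegree_mk_of_nonneg hΦ X d δ hδ _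

/-- **The non-negative cone of `(Pic, δ)` IS the set of classes of `Φ^rlf(L)`** — the 'order structure' induced via
`δ_A` is the one defined by the (effective) realified divisor monoid; this is the input `hcone`/`hmon` of
abc-iut-w4-d086's `Thm64ii_L02_orderCompat_of_cones/_of_monoidIso` at THE realified arithmetic Frobenioids.
[cite: MochizukiFrdI2008, Thm. 6.4 (ii) p.115] -/
theorem arith_picDegree_nonneg_iff
    (x : ((RealificationData.canonical (arithDivisorFunctor F K) (PreFrobenioid.IsPerfFactorialOn.op hΦ)).realSpan
        (PreFrobenioid.biratSubfunctor
          (ModelFrobenioid.toElem (arithDivisorFunctor F K) (unitsFunctor F K) (divNatTrans F K)))).Pic X) :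
    0 ≤ Multiplicative.toAdd (δ x) ↔
      ∃ a : (PreFrobenioid.IsPerfFactorialOn.op hΦ (op X)).Rlf, x = QuotientGroup.mk' _ (Algebra.GrothendieckGroup.of a) := by
  constructor
  · intro hx
    obtain ⟨D, hD⟩ := (arith_picDegree_nonneg_iff_iota hΦ X d hd δ hδ x).mp hx
    exact ⟨_, hD⟩
  · rintro ⟨a, rfl⟩
    exact arith_picDegree_mk_of_nonneg hΦ X d δ hδ a

/-- **`ξ ∈ (ℝ · Φ^birat)(L)` iff the real degree of `ξ` vanishes** (`δ` is injective on `Pic`): the kernel of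
`((ℝ_{≥0})^gp → ℝ) ∘ d^gp` on `(Φ^rlf)^gp(L)` IS `(ℝ · Φ^birat)(L)` — "is equal to the set of elements of
`(Φ^rlf_factor)^gp(L)` with finite support whose image under `deg^arith_L` is `0`". [cite: MochizukiFrdI2008, Thm. 6.4 (i) p.115] -/
theorem arith_mem_realSpan_iff_picDegree_eq_one
    (ξ : Algebra.GrothendieckGroup ((RealificationData.canonical (arithDivisorFunctor F K)
      (PreFrobenioid.IsPerfFactorialOn.op hΦ)).rlf.obj (op X))) :
    ξ ∈ ((RealificationData.canonical (arithDivisorFunctor F K) (PreFrobenioid.IsPerfFactorialOn.op hΦ)).realSpan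
        (PreFrobenioid.biratSubfunctor
          (ModelFrobenioid.toElem (arithDivisorFunctor F K) (unitsFunctor F K) (divNatTrans F K)))).carrier X ↔
      δ (QuotientGroup.mk' _ ξ) = 1 := by
  rw [← QuotientGroup.eq_one_iff, QuotientGroup.mk'_apply]
  constructor
  · intro h
    rw [h, map_one]
  · intro h
    exact arith_picDegree_injective hΦ X d hd δ hδ (h.trans (map_one δ).symm)

omit hd hδ in
/-- Bookkeeping in a group `G` with a real-valued character `φ`: if `φ a = s`, `φ b = s'`, `φ ξ = s - s'` and
`k = a / b`, then `φ (ξ / k) = 0` (multiplicatively: `= 1`). [cite: MochizukiFrdI2008, Thm. 6.4 (i) p.115] -/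
theorem apply_div_eq_one_of_degrees {G : Type*} [Group G] (φ : G →* Multiplicative ℝ) (ξ k a b : G) (s s' : ℝ)
    (hk : k = a / b) (ha : φ a = Multiplicative.ofAdd s) (hb : φ b = Multiplicative.ofAdd s')
    (hξ : φ ξ = Multiplicative.ofAdd (s - s')) : φ (ξ / k) = 1 := by
  rw [hk, map_div, map_div, ha, hb, ← ofAdd_sub, hξ, div_self']

omit hd hδ in
include hΦ in
/-- **Every `ξ ∈ (Φ^rlf)^gp(L)` is congruent modulo `(ℝ · Φ^birat)(L)` to `ι^gp(c)` for some `c ∈ Φ^gp(L)`**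
(archimedean adjustment: `c = D₊ − D₋` with `D_±` supported at one archimedean place and `deg ι(c) = deg ξ`; then
`ξ / ι^gp(c)` has degree `0`, i.e. lies in `ℝ · Φ^birat(L)`).  In model-Frobenioid terms: every object `(Spec L, ξ)`
of `C_{K/F}^rlf` has the class of an `untrToRlf`-image object `(Spec L, ι^gp(c))`.
[cite: MochizukiFrdI2008, Thm. 6.4 (i) p.115] -/
theorem arith_exists_div_toRlfGp_mem_realSpan
    (ξ : Algebra.GrothendieckGroup ((RealificationData.canonical (arithDivisorFunctor F K)
      (PreFrobenioid.IsPerfFactorialOn.op hΦ)).rlf.obj (op X))) :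
    ∃ c : Algebra.GrothendieckGroup ((arithDivisorFunctor F K).obj (op X)),
      ξ / (RealificationData.canonical (arithDivisorFunctor F K) (PreFrobenioid.IsPerfFactorialOn.op hΦ)).toRlfGp X c ∈
        ((RealificationData.canonical (arithDivisorFunctor F K) (PreFrobenioid.IsPerfFactorialOn.op hΦ)).realSpan
          (PreFrobenioid.biratSubfunctor
            (ModelFrobenioid.toElem (arithDivisorFunctor F K) (unitsFunctor F K) (divNatTrans F K)))).carrier X := by
  obtain ⟨d₁, hd₁⟩ := arith_exists_rlfDegree hΦ X
  obtain ⟨δ₁, hδ₁, -⟩ := arith_existsUnique_picDegree hΦ X d₁ hd₁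
  obtain ⟨D₁, hD₁⟩ := arith_exists_iota_picDegree_eq hΦ X d₁ hd₁ δ₁ hδ₁ _
    (le_max_right (Multiplicative.toAdd (δ₁ (QuotientGroup.mk' _ ξ))) 0)
  obtain ⟨D₂, hD₂⟩ := arith_exists_iota_picDegree_eq hΦ X d₁ hd₁ δ₁ hδ₁ _
    (le_max_right (-Multiplicative.toAdd (δ₁ (QuotientGroup.mk' _ ξ))) 0)
  refine ⟨Algebra.GrothendieckGroup.of (Multiplicative.ofAdd D₁) / Algebra.GrothendieckGroup.of (Multiplicative.ofAdd D₂),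
    ?_⟩
  have h1 : ∀ D : EffArithDivisor X.L,
      (RealificationData.canonical (arithDivisorFunctor F K) (PreFrobenioid.IsPerfFactorialOn.op hΦ)).toRlfGp X
        (Algebra.GrothendieckGroup.of (Multiplicative.ofAdd D)) =
      Algebra.GrothendieckGroup.of ((PreFrobenioid.IsPerfFactorialOn.op hΦ (op X)).toRealification
        (Perfection.of _ (Multiplicative.ofAdd D))) := fun D => MonGp.map_of _ _
  have key : (RealificationData.canonical (arithDivisorFunctor F K) (PreFrobenioid.IsPerfFactorialOn.op hΦ)).toRlfGp X
      (Algebra.GrothendieckGroup.of (Multiplicative.ofAdd D₁) / Algebra.GrothendieckGroup.of (Multiplicative.ofAdd D₂)) =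
      Algebra.GrothendieckGroup.of ((PreFrobenioid.IsPerfFactorialOn.op hΦ (op X)).toRealification
        (Perfection.of _ (Multiplicative.ofAdd D₁))) /
      Algebra.GrothendieckGroup.of ((PreFrobenioid.IsPerfFactorialOn.op hΦ (op X)).toRealification
        (Perfection.of _ (Multiplicative.ofAdd D₂))) :=
    (map_div _ _ _).trans (congrArg₂ (· / ·) (h1 D₁) (h1 D₂))
  rw [arith_mem_realSpan_iff_picDegree_eq_one hΦ X d₁ hd₁ δ₁ hδ₁]
  exact apply_div_eq_one_of_degrees (δ₁.comp (QuotientGroup.mk' _)) ξ _ _ _ _ _ key hD₁ hD₂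
    (by rw [max_zero_sub_max_neg_zero_eq_self, ofAdd_toAdd]; rfl)

end ArithRlfPic

end Literature.AlgebraicGeometry.Frobenioids

end
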